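import Summits.ABC.IUTFork.Joshi.TestGenuinePinsVacuity
import Summits.ABC.IUTFork.Cor312PinnedThetaRealSharpNegativeCriterion
import Summits.ABC.IUTFork.Thm311RealIsmDHNonIsometryMover
import HarnessLib

/-!
# Branch E TEST — the genuine-carrier pins are UNSATISFIABLE at EVERY tame place, bad primes included
# (discharge of `TestGenuinePinsVacuity`'s criterion from the Team R «ismDH mover» record, WITHOUT its hypothesis on `S`)

Proof-only sequel (abc-iut cell, block E, rung LADDER-ABC:A2.E; seat abc-iut-E-t44, gen 3; 0 definitions, no `Prop` fact) to this
seat's `Joshi/TestGenuinePinsVacuity.lean` (p445249). PRIOR ART, consumed BY NAME and not restated: the Θ-pin negative at the sharp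
real settings is abc-iut-w4-d087's `Cor312PinnedThetaRealSharpNegative` (p430919; interface lemma
`Cor312Vol.image_thetaRegion_eq_of_thetaPinned`, the one-place Dupuy–Hilado mover) with abc-iut-w5-d044's
`Cor312PinnedThetaRealSharpNegativeCriterion(Pr)` (mover abstracted; tame / wild-inclusive supplies from abc-iut-w5-d180's
ball-mover criterion p432150 and abc-iut-w5-d216's `IsmDHMover`/`NonIsometryMover`). Those records build the (Ind2)-family «`ψ` at
`v₀` AT EVERY LABEL, identity elsewhere», whose star-action is trivial only OFF the prime `p₀` of `v₀`; hence each of their negatives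
carries the side condition «no place of `S` over `p₀`» (`hS : ∀ v ∈ V^bad, v_ℚ(v) ≠ p₀`). p445249's family acts at the single slot
`(0, p₀)` — the label `0 ∉ 𝔽_l^⋇` is never read by the star-action — so its criterion needs NO hypothesis on `S`. THIS FILE feeds
the record's mover supply into that criterion:

* `exists_ismDH_moves_integer_of_image_integers_ne` — dictionary: a `ψ ∈ Real.ismDH (analyticLogv F) (inr v₀)` with
  `ψ(𝒪_{v₀}) ≠ 𝒪_{v₀}` (the record's currency) yields `g₀ ∈ ismDH` and `x₀` with `‖φ x₀‖ ≤ 1 < ‖φ (g₀ x₀)‖` (p445249's currency; `g₀ = ψ`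
  or `ψ⁻¹` by `IsmDHMover.exists_of_image_ne`, `NonIsometryMover.symm_mem_ismDH`; `φ` = abc-iut-c312-5's presentation =
  `RescaledCompletion.of`, `mem_integers_iff_norm_rescaled_le_one`);
* **`not_pinnedRegions_settingPrVolSharp_of_exists_mover_anyPrime`** / `…3…` — for the ANALYTIC logarithms, ONE mover of the unit
  ball at ONE finite place `v₀` (over ANY prime, places of `S` above it or not) makes `Cor312Vol.PinnedRegions` / `PinnedRegions3`
  FALSE at abc-iut-c312-7's `settingPrVolSharp` over `LatticeSituation.ofShells (logShellsDH X (analyticLogv F)) …` for EVERY `ρ`, `qK`,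
  column data, `Ψ`, ideles `t`, `tq`, column `n`;
* **`not_pinnedRegions_settingPrVolSharp_of_tame_anyPrime`** / `…3…` — hence as soon as `F` has ONE place `v₀` over an odd prime
  `p₀` with `2 ≤ e(v₀|p₀) ≤ p₀ − 2` (any residue degree; `exists_ismDH_image_integers_ne_of_tame`), and
  `not_pinnedRegions_settingPrVolSharp_of_forall_ne_anyPrime` — as soon as the unit ball of some `K_{v₀}` is no
  `p₀^k·log_{p₀}(𝒪_{v₀}^×)` (wild ramification included; `exists_ismDH_image_integers_ne_of_forall_ne`).

CONSEQUENCE FOR THE RECORD (tree currency, no side taken): at every such `F` the genuine-carrier clauses «(ii)(b)@n ∧ (pΘ) ∧ (pq′)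
⟹ ¬S» of abc-iut-C-cert-1 p430714, abc-iut-E-t4 p436213 and this seat's p438843 (all stated at `settingPrVolSharp` with `PinnedRegions`
as a HYPOTHESIS) hold VACUOUSLY when read at `logv = analyticLogv F`; the located sentence of E-LOCATION §L2 should therefore keep
the implication form AND name this vacuity (the (Ind2)-stable lattice boxes / an isometric Ism are the pin-compatible readings —
abc-iut-w5-d180's criterion: NO mover exists at unramified odd places). HONEST SCOPE: OUR interface, OUR sharp real container, DH's
reading of (Ind2) (`Aut_{ℚ_p}(K_v : I_v)`); nothing here bears on print's (xi-e)/(xi-f). [claim: Mochizuki2012, status: disputed]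
[cite: DupuyHilado2025, §3.9, §4.9] [cite: ScholzeStix2018, §2.2 pp. 9–10]
-/

noncomputable section

open Set Function NumberField IsDedekindDomain Metric
open scoped Pointwise

namespace Summit.ABC.IUTFork.Joshi

open Thm311 Thm311.Real Cor312 Cor312Vol Literature.IUT.LogThetaLattice Literature.IUT.LogVolume
  Literature.IUT.HodgeTheaters Literature.NumberTheory.NumberFields

variable {F : Type} [Field F] [NumberField F] (X : PilotData F)
  (M : Type) [Field M] [NumberField M]
  (archPk : ∀ (j : (thetaIndex X).Label) (vQ : (thetaIndex X).VQ), Set ((logShellsDH X (analyticLogv F)).Packet j vQ))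
  (archSub : ∀ (j : (thetaIndex X).Label) (v : (thetaIndex X).V),
    Set ((logShellsDH X (analyticLogv F)).Packet j ((thetaIndex X).over v)))
  (Ψ : ℤ → ∀ v : (thetaIndex X).V, v ∈ (thetaIndex X).Vbad → Set ((logShellsDH X (analyticLogv F)).StarPacket v))
  (act : ℤ → ∀ v : (thetaIndex X).V, v ∈ (thetaIndex X).Vbad →
    (logShellsDH X (analyticLogv F)).StarPacket v → Module.End ℚ ((logShellsDH X (analyticLogv F)).StarPacket v))
  (Mmod : ℤ → ∀ j : (thetaIndex X).LabelStar, Set ((logShellsDH X (analyticLogv F)).GlobalPacket j.1))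
  (region : ℤ → ∀ j : (thetaIndex X).LabelStar, FinDivisor M → ∀ vQ : (thetaIndex X).VQ,
    Set ((logShellsDH X (analyticLogv F)).Packet j.1 vQ))
  (frobAdm : ℤ → ℤ → ∀ (j : (thetaIndex X).Label) (vQ : (thetaIndex X).VQ),
    Set ((logShellsDH X (analyticLogv F)).Packet j vQ) → Prop)
  (frobLogvol : ℤ → ℤ → ∀ (j : (thetaIndex X).Label) (vQ : (thetaIndex X).VQ),
    Set ((logShellsDH X (analyticLogv F)).Packet j vQ) → ℝ)
  (frobΨ : ℤ → ℤ → ∀ v : (thetaIndex X).V, v ∈ (thetaIndex X).Vbad → Set ((logShellsDH X (analyticLogv F)).StarPacket v))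
  (frobMmod : ℤ → ℤ → ∀ j : (thetaIndex X).LabelStar, Set ((logShellsDH X (analyticLogv F)).GlobalPacket j.1))
  (unitImage : ℤ → ℤ → ℕ → ∀ (j : (thetaIndex X).Label) (vQ : (thetaIndex X).VQ),
    Set ((logShellsDH X (analyticLogv F)).Packet j vQ))
  (ballImage : ℤ → ℤ → ∀ (j : (thetaIndex X).Label) (vQ : (thetaIndex X).VQ),
    Set ((logShellsDH X (analyticLogv F)).Packet j vQ))
  (thetaDiv : ℤ → ℤ → LgpDivisor M (thetaIndex X).lstar)
  (n : ℤ) {HT : Type} {LogLink : HT → HT → Type} {IsFull : ∀ {s t : HT}, LogLink s t → Prop}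
  (lat : LGPGaussianLogThetaLattice LogLink IsFull)
  {Frd : Type} {IsoF : Frd → Frd → Type} {Ob : Frd → Type} {realify : Frd → Frd} {Strip : Type}
  {IsoS : Strip → Strip → Type} {Mv : ∀ v : (thetaIndex X).V, v ∈ (thetaIndex X).Vbad → Type}
  [∀ v h, Monoid (Mv v h)]
  (sig : GlobalLGPFrobenioidSignature (thetaIndex X).lstar (thetaIndex X).V (· ∈ (thetaIndex X).Vbad)
    Frd IsoF Ob realify Strip IsoS Mv)
  (split : SplittingMonoids Mv) {ObΔ : Type} {N : ∀ v : (thetaIndex X).V, v ∈ (thetaIndex X).Vbad → Type}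
  [∀ v h, Monoid (N v h)] (qData : QPilotData ObΔ N)
  (t : ∀ (pp : Nat.Primes) (_ : Fin X.lstar) (x : (thetaIndex X).Fibre (.inr pp)),
    haveI : Fact (pp : ℕ).Prime := ⟨pp.2⟩; kOf X pp.1 x)
  (tq : ∀ (pp : Nat.Primes) (x : (thetaIndex X).Fibre (.inr pp)), haveI : Fact (pp : ℕ).Prime := ⟨pp.2⟩; kOf X pp.1 x)
  (ρ : (∀ v : (thetaIndex X).V, v ∈ (thetaIndex X).Vbad → Set ((logShellsDH X (analyticLogv F)).StarPacket v)) →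
    ∀ (j : (thetaIndex X).Label) (vQ : (thetaIndex X).VQ), Set ((logShellsDH X (analyticLogv F)).Packet j vQ))
  (qK : ∀ v : (thetaIndex X).V, v ∈ (thetaIndex X).Vbad → Set ((logShellsDH X (analyticLogv F)).StarPacket v))
  (htq0 : ∀ pp x, tq pp x ≠ 0)
  (htq1 : ∀ (pp : Nat.Primes) (x : (thetaIndex X).Fibre (.inr pp)),
    haveI : Fact (pp : ℕ).Prime := ⟨pp.2⟩; placeOf X pp.1 x ∉ X.S → ‖tq pp x‖ = 1)

/-! ## 1. Dictionary between the two mover currencies -/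

/-- A Dupuy–Hilado (Ind2) element `ψ` at `v₀` with `ψ(𝒪_{v₀}) ≠ 𝒪_{v₀}` (abc-iut-w5-d044's currency) yields `g₀ ∈ Real.ismDH` and a
local integer `x₀` that `g₀` carries out of the unit ball, read through abc-iut-c312-5's presentation at `p₀` (p445249's currency):
`g₀ = ψ` if `ψ` moves an integer out, `g₀ = ψ⁻¹` if it moves a non-integer in. [cite: DupuyHilado2025, §4.9] -/
theorem exists_ismDH_moves_integer_of_image_integers_ne (pp : Nat.Primes) (v₀ : HeightOneSpectrum (𝓞 F))
    (hv₀ : (thetaIndex X).over (.inr v₀) = .inr pp)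
    (hmov : ∃ ψ ∈ ismDH (analyticLogv F) (.inr v₀ : Thm311.Real.Place F),
      ⇑ψ '' (integers v₀ : Set (Carrier (.inr v₀ : Thm311.Real.Place F))) ≠ integers v₀) :
    haveI : Fact (pp : ℕ).Prime := ⟨pp.2⟩
    ∃ g₀ ∈ ismDH (analyticLogv F) (.inr v₀ : Thm311.Real.Place F), ∃ x₀ : Carrier (.inr v₀ : Thm311.Real.Place F),
      ‖(presAt X (logvAnalytic_analyticLogv (F := F)) pp).φ ⟨.inr v₀, hv₀⟩ x₀‖ ≤ 1 ∧
        1 < ‖(presAt X (logvAnalytic_analyticLogv (F := F)) pp).φ ⟨.inr v₀, hv₀⟩ (g₀ x₀)‖ := by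
  haveI : Fact (pp : ℕ).Prime := ⟨pp.2⟩
  have hv : ((pp : ℕ) : 𝓞 F) ∈ v₀.asIdeal := natCast_mem_placeOf X pp ⟨.inr v₀, hv₀⟩
  -- abc-iut-c312-5's presentation at `v₀` IS the identity `K_{v₀} ≃ K_{v₀}^{(1/n)}` (`RescaledCompletion.of`)
  let e : Carrier (.inr v₀ : Thm311.Real.Place F) ≃+* kOf X pp.1 ⟨.inr v₀, hv₀⟩ := RescaledCompletion.of F pp v₀ hv
  have hφ : ∀ z : Carrier (.inr v₀ : Thm311.Real.Place F),
      (presAt X (logvAnalytic_analyticLogv (F := F)) pp).φ ⟨.inr v₀, hv₀⟩ z = e z := fun z => rfl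
  have hint : ∀ z : Carrier (.inr v₀ : Thm311.Real.Place F),
      z ∈ (integers v₀ : Set (Carrier (.inr v₀ : Thm311.Real.Place F))) ↔ ‖e z‖ ≤ 1 := fun z =>
    mem_integers_iff_norm_rescaled_le_one F pp v₀ hv (e z)
  obtain ⟨ψ, hψ, hne⟩ := hmov
  rcases IsmDHMover.exists_of_image_ne ψ.toEquiv hne with ⟨z, hz, hψz⟩ | ⟨z, hz, hψz⟩
  · refine ⟨ψ, hψ, z, ?_, ?_⟩
    · rw [hφ]; exact (hint z).1 hz
    · rw [hφ]; exact not_le.1 fun h => hψz ((hint _).2 h)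
  · refine ⟨ψ.symm, NonIsometryMover.symm_mem_ismDH _ v₀ hψ, ψ z, ?_, ?_⟩
    · rw [hφ]; exact (hint _).1 hψz
    · rw [hφ]
      show 1 < ‖e (ψ.symm (ψ z))‖
      rw [LinearEquiv.symm_apply_apply]
      exact not_le.1 fun h => hz ((hint z).2 h)

/-! ## 2. The pins are unsatisfiable from ONE mover at ONE place — over ANY prime -/

/-- **ONE MOVER AT ONE PLACE, ANY PRIME (places of `S` above it or not): `PinnedRegions` FAILS at `settingPrVolSharp`** for the
analytic logarithms, for EVERY `ρ`, `qK`, column data, `Ψ`, ideles, column — p445249's criterion fed by §1 (no «no place of `S`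
over `p₀`» hypothesis: the single-slot family at `(0, p₀)` has trivial star-action at every prime). [claim: Mochizuki2012, status: disputed] -/
theorem not_pinnedRegions_settingPrVolSharp_of_exists_mover_anyPrime (pp : Nat.Primes) (v₀ : HeightOneSpectrum (𝓞 F))
    (hv₀ : (thetaIndex X).over (.inr v₀) = .inr pp)
    (hmov : ∃ ψ ∈ ismDH (analyticLogv F) (.inr v₀ : Thm311.Real.Place F),
      ⇑ψ '' (integers v₀ : Set (Carrier (.inr v₀ : Thm311.Real.Place F))) ≠ integers v₀) :
    ¬ Cor312Vol.PinnedRegions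
      (LatticeSituation.ofShells (logShellsDH X (analyticLogv F)) M archPk archSub
        (summandPiecesPr X (logvAnalytic_analyticLogv (F := F))).Adm
        (summandPiecesPr X (logvAnalytic_analyticLogv (F := F))).logvol Ψ act Mmod region frobAdm frobLogvol frobΨ frobMmod
        unitImage ballImage thetaDiv)
      (settingPrVolSharp X (logvAnalytic_analyticLogv (F := F)) M archPk archSub Ψ act Mmod region n lat sig split qData tq t
        htq0 htq1) ρ qK := by
  obtain ⟨g₀, hg₀, x₀, hx₀, hgx₀⟩ := exists_ismDH_moves_integer_of_image_integers_ne X pp v₀ hv₀ hmov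
  exact not_pinnedRegions_settingPrVolSharp_of_ismDH_moves_integer X (logvAnalytic_analyticLogv (F := F)) M archPk archSub Ψ
    act Mmod region frobAdm frobLogvol frobΨ frobMmod unitImage ballImage thetaDiv n lat sig split qData t tq ρ qK htq0 htq1 pp
    ⟨.inr v₀, hv₀⟩ hg₀ hx₀ hgx₀

/-- The same for `PinnedRegions3`. [claim: Mochizuki2012, status: disputed] -/
theorem not_pinnedRegions3_settingPrVolSharp_of_exists_mover_anyPrime (pp : Nat.Primes) (v₀ : HeightOneSpectrum (𝓞 F))
    (hv₀ : (thetaIndex X).over (.inr v₀) = .inr pp)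
    (hmov : ∃ ψ ∈ ismDH (analyticLogv F) (.inr v₀ : Thm311.Real.Place F),
      ⇑ψ '' (integers v₀ : Set (Carrier (.inr v₀ : Thm311.Real.Place F))) ≠ integers v₀) :
    ¬ Cor312Vol.PinnedRegions3
      (LatticeSituation.ofShells (logShellsDH X (analyticLogv F)) M archPk archSub
        (summandPiecesPr X (logvAnalytic_analyticLogv (F := F))).Adm
        (summandPiecesPr X (logvAnalytic_analyticLogv (F := F))).logvol Ψ act Mmod region frobAdm frobLogvol frobΨ frobMmod
        unitImage ballImage thetaDiv)
      (settingPrVolSharp X (logvAnalytic_analyticLogv (F := F)) M archPk archSub Ψ act Mmod region n lat sig split qData tq t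
        htq0 htq1) ρ qK :=
  fun h => not_pinnedRegions_settingPrVolSharp_of_exists_mover_anyPrime X M archPk archSub Ψ act Mmod region frobAdm frobLogvol
    frobΨ frobMmod unitImage ballImage thetaDiv n lat sig split qData t tq ρ qK htq0 htq1 pp v₀ hv₀ hmov h.1

/-! ## 3. Tame places (any residue degree) and the wild-inclusive form — no hypothesis on `S` -/

/-- **TAME PLACES, BAD PRIMES INCLUDED: `PinnedRegions` FAILS at `settingPrVolSharp`** (analytic logarithms) as soon as `F` has ONE
place `v₀` over an odd prime `p₀` with `2 ≤ e(v₀|p₀) ≤ p₀ − 2` — for every `ρ`, `qK`, column data, `Ψ`, ideles, column. The mover is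
abc-iut-w5-d044's `exists_ismDH_image_integers_ne_of_tame` (w5-d180's criterion: `log_{p₀}(𝒪^×) = 𝔪`, `e ∤ −1`).
[cite: DupuyHilado2025, §4.9] [claim: Mochizuki2012, status: disputed] -/
theorem not_pinnedRegions_settingPrVolSharp_of_tame_anyPrime (pp : Nat.Primes) (hp2 : 2 < (pp : ℕ))
    (v₀ : HeightOneSpectrum (𝓞 F)) (hv₀ : (thetaIndex X).over (.inr v₀) = .inr pp)
    (he2 : 2 ≤ v₀.asIdeal.ramificationIdx ℤ) (hep : v₀.asIdeal.ramificationIdx ℤ ≤ (pp : ℕ) - 2) :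
    ¬ Cor312Vol.PinnedRegions
      (LatticeSituation.ofShells (logShellsDH X (analyticLogv F)) M archPk archSub
        (summandPiecesPr X (logvAnalytic_analyticLogv (F := F))).Adm
        (summandPiecesPr X (logvAnalytic_analyticLogv (F := F))).logvol Ψ act Mmod region frobAdm frobLogvol frobΨ frobMmod
        unitImage ballImage thetaDiv)
      (settingPrVolSharp X (logvAnalytic_analyticLogv (F := F)) M archPk archSub Ψ act Mmod region n lat sig split qData tq t
        htq0 htq1) ρ qK :=
  haveI : Fact (pp : ℕ).Prime := ⟨pp.2⟩
  not_pinnedRegions_settingPrVolSharp_of_exists_mover_anyPrime X M archPk archSub Ψ act Mmod region frobAdm frobLogvol frobΨ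
    frobMmod unitImage ballImage thetaDiv n lat sig split qData t tq ρ qK htq0 htq1 pp v₀ hv₀
    (exists_ismDH_image_integers_ne_of_tame pp hp2 v₀ (natCast_mem_placeOf X pp ⟨.inr v₀, hv₀⟩) he2 hep)

/-- The same for `PinnedRegions3` (so abc-iut-C-cert-1's `shrink1_antecedent_refuted_of_realising` and this seat's
`not_pilotKummerIndRelated_settingPrVolSharp_of_pinned3_anyQ` are vacuous at every such `F`, read at the analytic logarithms).
[claim: Mochizuki2012, status: disputed] -/
theorem not_pinnedRegions3_settingPrVolSharp_of_tame_anyPrime (pp : Nat.Primes) (hp2 : 2 < (pp : ℕ))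
    (v₀ : HeightOneSpectrum (𝓞 F)) (hv₀ : (thetaIndex X).over (.inr v₀) = .inr pp)
    (he2 : 2 ≤ v₀.asIdeal.ramificationIdx ℤ) (hep : v₀.asIdeal.ramificationIdx ℤ ≤ (pp : ℕ) - 2) :
    ¬ Cor312Vol.PinnedRegions3
      (LatticeSituation.ofShells (logShellsDH X (analyticLogv F)) M archPk archSub
        (summandPiecesPr X (logvAnalytic_analyticLogv (F := F))).Adm
        (summandPiecesPr X (logvAnalytic_analyticLogv (F := F))).logvol Ψ act Mmod region frobAdm frobLogvol frobΨ frobMmod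
        unitImage ballImage thetaDiv)
      (settingPrVolSharp X (logvAnalytic_analyticLogv (F := F)) M archPk archSub Ψ act Mmod region n lat sig split qData tq t
        htq0 htq1) ρ qK :=
  fun h => not_pinnedRegions_settingPrVolSharp_of_tame_anyPrime X M archPk archSub Ψ act Mmod region frobAdm frobLogvol frobΨ
    frobMmod unitImage ballImage thetaDiv n lat sig split qData t tq ρ qK htq0 htq1 pp hp2 v₀ hv₀ he2 hep h.1

/-- **WILD RAMIFICATION INCLUDED, BAD PRIMES INCLUDED**: `PinnedRegions` FAILS at `settingPrVolSharp` as soon as the unit ball of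
some `K_{v₀}` is no `p₀^k·log_{p₀}(𝒪_{v₀}^×)`, `k ∈ ℤ` (abc-iut-w5-d044's `exists_ismDH_image_integers_ne_of_forall_ne`, w5-d180's
criterion). [cite: DupuyHilado2025, §4.9] [claim: Mochizuki2012, status: disputed] -/
theorem not_pinnedRegions_settingPrVolSharp_of_forall_ne_anyPrime (pp : Nat.Primes) (v₀ : HeightOneSpectrum (𝓞 F))
    (hv₀ : (thetaIndex X).over (.inr v₀) = .inr pp) (hv : ((pp : ℕ) : 𝓞 F) ∈ v₀.asIdeal)
    (hne : haveI : Fact (pp : ℕ).Prime := ⟨pp.2⟩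
      ∀ k : ℤ, closedBall (0 : RescaledCompletion F pp v₀ hv) 1 ≠
        (((pp : ℕ) : ℚ_[pp]) ^ k) • (logUnits (RescaledCompletion F pp v₀ hv) : Set (RescaledCompletion F pp v₀ hv))) :
    ¬ Cor312Vol.PinnedRegions
      (LatticeSituation.ofShells (logShellsDH X (analyticLogv F)) M archPk archSub
        (summandPiecesPr X (logvAnalytic_analyticLogv (F := F))).Adm
        (summandPiecesPr X (logvAnalytic_analyticLogv (F := F))).logvol Ψ act Mmod region frobAdm frobLogvol frobΨ frobMmod
        unitImage ballImage thetaDiv)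
      (settingPrVolSharp X (logvAnalytic_analyticLogv (F := F)) M archPk archSub Ψ act Mmod region n lat sig split qData tq t
        htq0 htq1) ρ qK :=
  not_pinnedRegions_settingPrVolSharp_of_exists_mover_anyPrime X M archPk archSub Ψ act Mmod region frobAdm frobLogvol frobΨ
    frobMmod unitImage ballImage thetaDiv n lat sig split qData t tq ρ qK htq0 htq1 pp v₀ hv₀
    (exists_ismDH_image_integers_ne_of_forall_ne pp v₀ hv hne)

end Summit.ABC.IUTFork.Joshi

end
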